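import Literature.NumberTheory.Sieve.FriedlanderIwaniecPrimesGaussianParam
import Literature.NumberTheory.Sieve.FriedlanderIwaniecPrimesBilinearForm
import Literature.NumberTheory.QuadraticFields.GaussianPrimary
import Mathlib.Analysis.SpecialFunctions.Complex.Arg
import HarnessLib

/-!
# Friedlander–Iwaniec, *The polynomial `X² + Y⁴` captures its primes*, §5: the sector forms `B(M, N)` of (5.10)–(5.13)

Family `parity`, statement parity.S17 (`setOf_prime_sq_add_pow_four_infinite`). Source: J. Friedlander,
H. Iwaniec, Ann. of Math. (2) 148 (1998), 945–1040 [FriedlanderIwaniecAnnals1998], §5 "The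
bilinear form in the sieve: Transformations", (5.6)–(5.16), with the parameter conventions of §4
((4.11)–(4.16)) and §18.

After (5.2)–(5.6) (`FriedlanderIwaniecPrimesGaussianParam`, `…GaussianForm`: `B*(M, N)` is a
bilinear form over Gaussian integers `w`, `z`, `z` primary), §5 (i) fixes the class of `z` modulo
`8` — (5.7) "`z ≡ z₀ (mod 8)` where `z₀` is primary. This can be accomplished by splitting
`B*(M, N)` into eight such classes"; (ii) removes the condition `(w w̄, z z̄) = 1` at the cost (5.10),
arriving at "the free bilinear form `B(M, N) = Σ_w Σ_z α_w β_z 𝔷(Re w̄ z)`"; (iii) restricts `β_z`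
to a narrow sector — (5.12) "`φ < arg z ≤ φ + 2πθ` for some `-π < φ < π` where `θ` is the same as
in (4.12) … we attach to `β_z` a periodic function `q(α)` of period `2π` supported on
`φ < α ≤ φ + 2πθ` such that `q^{(j)} ≪ θ^{-j}`, `j = 0, 1, 2`. Thus from now on
(5.13) `β_z = q(α) p(n) μ(n) Σ_{c ∣ n, c ≤ C} μ(c)` where `α = arg z` and `n = |z|²`";
and states the target: "we now need to prove that for the bilinear form `B(M, N)` restricted
smoothly to a box we have (5.15) `B(M, N) ≪ ϑ θ² (MN)^{3/4} (log MN)⁴` … We can assume that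
`|φ (mod π/2)| > πϑ` because the other sectors, altogether of angle `≤ 2πϑ`, contribute no more than
the bound (4.23) by the estimate (5.16). For `z = r + is` in any remaining polar box we are not near
either axis". (5.15) is proved in §§5–26 of the source for the sectors away from the axes.

This file fixes the objects: the argument of a Gaussian integer, the class condition (5.7) and the
free sector form `B(M, N)`.

## (5.15) is not vendored as a named fact (D-0026 review, 2026-08-15)

An earlier version of this file vendored (5.15) as a closed named fact
`FriedlanderIwaniec1998_bilinear515`, as the planned input of a §5-type reduction of (4.23). That
reduction was never formalised, and (5.15) — like (4.23) — is a waypoint inside the proof of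
Proposition 4.1 (its proof is §§5–26: lattice points in the biquadratic ellipse under a congruence,
mean-value theorems for Jacobi-twisted sums, a Siegel–Walfisz theorem for Hecke `L`-functions of
`ℚ(i)`, Jacobi–Kubota symbols), not a distinct, separately citable result; as a closed `def` it only
re-counted the one theorem that the tree cites as `FriedlanderIwaniec1998_prop41` (Proposition 4.1 as
printed, `FriedlanderIwaniecPrimes`), the single named fact of the tree for FI §§4–26. (4.23) itself
is the explicit hypothesis of the proved §4 reduction `FriedlanderIwaniec1998_prop41_of_bilinear423`
(`FriedlanderIwaniecPrimesBilinearReduction`). For a future formalisation of §5, the reviewed formal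
reading of (5.15) (p24087) was, with `θ = (log x)^{-A'}`, `τ = (log x)^t`, `ϑ = (log x)^{-A}` and the
quantifier prefix of (4.23) (`∀ η A A₁ > 0, ∃ A' ≥ 2A + 2^20, ∃ t ≥ A + 124, ∃ B > 0, ∃ K > 0`, for all
large `x`, all `P` in (4.4), `N` in (4.6), `M` with `x(log x)^{-A₁} < MN < x`, `C` with
`1 ≤ C ≤ N^{1-η}`, `N'` with `N < N' < 2N`, `p` as in (4.12)–(4.14) normalised):

    ∀ z₀ : GaussianInt,
    ∀ φ : ℝ, (∃ k : ℤ, k * (π / 2) + π * ϑ < φ ∧ φ + 2 * π * θ < (k + 1) * (π / 2) - π * ϑ) →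
    ∀ q : ℝ → ℝ, ContDiff ℝ 2 q → Function.Periodic q (2 * π) →
      (∀ u, q u ≠ 0 → ∃ k : ℤ, φ < u - 2 * π * k ∧ u - 2 * π * k ≤ φ + 2 * π * θ) →
      (∀ u, |q u| ≤ 1) → (∀ u, |deriv q u| ≤ θ⁻¹) → (∀ u, |deriv (deriv q) u| ≤ θ⁻¹ ^ 2) →
    ∀ α : ℕ → ℂ, (∀ m, ‖α m‖ ≤ 1) →
      ‖fiGaussSector α q p z₀ M N' θ C P τ‖ ≤ K * ϑ * θ ^ 2 * (M * N) ^ (3 / 4 : ℝ) * Real.log (M * N) ^ 4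

i.e. every primary class `z₀`, every sector `(φ, φ + 2πθ]` lying inside an open quadrant at angular
distance `> πϑ` from both axes (the printed "`|φ (mod π/2)| > πϑ`", made precise so that the whole
sector avoids the axes), every `2π`-periodic `C²` function `q` supported on the sector modulo `2π`
with `|q| ≤ 1`, `|q'| ≤ θ⁻¹`, `|q''| ≤ θ⁻²` ((5.12)–(5.13) normalised), and all `α` with `|α| ≤ 1`.

## Contents

* `FriedlanderIwaniecPrimes.gaussArg z` — `arg z ∈ (-π, π]` of a Gaussian integer (through
  `GaussianInt.toComplex` and `Complex.arg`); `FriedlanderIwaniecPrimes.GaussCongrEight z₀ z` — (5.7)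
  `z ≡ z₀ (mod 8)` (decidable form, `gaussCongrEight_iff`);
* `FriedlanderIwaniecPrimes.fiGaussSector α q p z₀ M N' θ C P τ` — the free form `B(M, N)` of
  (5.10) with the coefficients (5.13) restricted by (5.7)–(5.9):
  `Σ_{M < |w|² ≤ 2M} Σ_{z primary, z ≡ z₀ (8)} α(|w|²) q(arg z) β(|z|²) 𝔷(Re w̄ z)`, `β = fiBeta p C P τ`
  ((4.13) with (4.21)–(4.22)), grouped by the norms `m = |w|²`, `n = |z|²`.

## References

* J. Friedlander, H. Iwaniec, Ann. of Math. (2) 148 (1998), 945–1040: §5 (5.6)–(5.16), §4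
  (4.11)–(4.16), §18. [FriedlanderIwaniecAnnals1998]

## Tree

`sqPairs`, `toGauss`, `fiZeta` (`…GaussianParam`), `fiBeta` (`…BilinearForm`), `primaryNormEq`,
`IsPrimary` (`QuadraticFields.GaussianPrimary`). Mathlib: `Complex.arg`, `GaussianInt.toComplex`,
`Function.Periodic`, `ContDiff`.
-/

noncomputable section

open Finset Real Filter
open Literature.NumberTheory.QuadraticFields.GaussianPrimary

namespace Literature.NumberTheory.Sieve

namespace FriedlanderIwaniecPrimes

/-- The argument `arg z ∈ (-π, π]` of a Gaussian integer, `α = arg z` of (5.12)–(5.13).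
[cite: FriedlanderIwaniecAnnals1998, (5.12)] -/
def gaussArg (z : GaussianInt) : ℝ := Complex.arg (GaussianInt.toComplex z)

/-- `gaussArg` unfolded. [cite: FriedlanderIwaniecAnnals1998, (5.12)] -/
theorem gaussArg_def (z : GaussianInt) : gaussArg z = Complex.arg (GaussianInt.toComplex z) := rfl

/-- The class condition (5.7) `z ≡ z₀ (mod 8)` in coordinates (`8 ∣ z - z₀` in `ℤ[i]` iff `8` divides
both coordinates, `Zsqrtd.intCast_dvd`). [cite: FriedlanderIwaniecAnnals1998, (5.7)] -/
def GaussCongrEight (z₀ z : GaussianInt) : Prop := (8 : ℤ) ∣ (z - z₀).re ∧ (8 : ℤ) ∣ (z - z₀).im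

/-- (5.7) is decidable. [folklore] -/
instance (z₀ z : GaussianInt) : Decidable (GaussCongrEight z₀ z) := inferInstanceAs (Decidable (_ ∧ _))

/-- `GaussCongrEight z₀ z ↔ 8 ∣ z - z₀` in `ℤ[i]`. [folklore] -/
theorem gaussCongrEight_iff (z₀ z : GaussianInt) : GaussCongrEight z₀ z ↔ (8 : GaussianInt) ∣ z - z₀ := by
  rw [GaussCongrEight, show (8 : GaussianInt) = ((8 : ℤ) : GaussianInt) by norm_num, Zsqrtd.intCast_dvd]

/-- FI's free sector form `B(M, N)` ((5.10) with the coefficients (5.13) and the support conventions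
(5.7)–(5.9), (4.21)–(4.22)):
`Σ_{M < |w|² ≤ 2M} Σ_{z primary, z ≡ z₀ (8), N' < |z|² ≤ (1+θ)N'} α(|w|²) q(arg z) β(|z|²) 𝔷(Re w̄ z)`,
`β = fiBeta p C P τ`, grouped by `m = |w|²` and `n = |z|²` (no coprimality condition between them:
"the free bilinear form"). [cite: FriedlanderIwaniecAnnals1998, (5.10) and (5.13) with (5.7)-(5.9)] -/
def fiGaussSector (α : ℕ → ℂ) (q p : ℝ → ℝ) (z₀ : GaussianInt) (M N' θ C P τ : ℝ) : ℂ :=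
  ∑ m ∈ Ioc ⌊M⌋₊ ⌊2 * M⌋₊, ∑ n ∈ Ioc ⌊N'⌋₊ ⌊(1 + θ) * N'⌋₊,
    α m * ((fiBeta p C P τ n : ℝ) : ℂ) *
      ((∑ uv ∈ sqPairs m, ∑ z ∈ (primaryNormEq n).filter (GaussCongrEight z₀),
          q (gaussArg z) * (fiZeta (star (toGauss uv) * z).re : ℝ) : ℝ) : ℂ)

/-- `fiGaussSector` unfolded. [cite: FriedlanderIwaniecAnnals1998, (5.10) and (5.13)] -/
theorem fiGaussSector_def (α : ℕ → ℂ) (q p : ℝ → ℝ) (z₀ : GaussianInt) (M N' θ C P τ : ℝ) :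
    fiGaussSector α q p z₀ M N' θ C P τ =
      ∑ m ∈ Ioc ⌊M⌋₊ ⌊2 * M⌋₊, ∑ n ∈ Ioc ⌊N'⌋₊ ⌊(1 + θ) * N'⌋₊,
        α m * ((fiBeta p C P τ n : ℝ) : ℂ) *
          ((∑ uv ∈ sqPairs m, ∑ z ∈ (primaryNormEq n).filter (GaussCongrEight z₀),
              q (gaussArg z) * (fiZeta (star (toGauss uv) * z).re : ℝ) : ℝ) : ℂ) :=
  rfl

end FriedlanderIwaniecPrimes

end Literature.NumberTheory.Sieve
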